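import Literature.Geometry.Symplectic.SteinBallHandle
import Literature.Geometry.Symplectic.LegendrianRealisation
import Literature.Topology.FourManifolds.NeckCapping
import Literature.Topology.FourManifolds.HCobordismIdealCircleProofs
import Literature.Topology.FourManifolds.SmoothEmbeddingCriteria
import HarnessLib

/-!
# The attaching circle of a 2-handle attaching map is a smooth embedding, hence a knot in `∂W`
# (proofs)

Topic `Literature/Geometry/Symplectic`; proofs-only companion of `AttachingFramingProofs.lean`
(the handle framing is a knot framing) closing the second tacit obligation recorded there and in
`TwoHandleIsotopy.lean`: for every attaching map `h̄ : T → W` of a 4-dimensional 2-handle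
(`HandleAttachingMap 3 2 W`, `HandleAttachingMaps.lean`) the attaching circle
`h.attachingCircle = h̄ ∘ (θ ↦ (θ, 0))` is a `C^∞` embedding `𝕊¹ → W`
(`isSmoothEmbedding_attachingCircle`), hence a knot in `∂W` (`isBoundaryKnot_attachingCircle`,
the input form of `IsBoundaryLink` / `LinkIsotopyInBoundary`, `LegendrianRealisation.lean`).

No inverse function theorem with boundary is needed: the model circle `θ ↦ (θ, 0)` is a smooth
embedding into `D⁴` (it is the Legendrian unknot of `SteinBallLegendrian.lean` moved by the
isometry `x₁ ↔ x₂` of `SteinBallHandle.lean`), hence into the open submanifold `T`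
(`Manifold.IsSmoothEmbedding.codRestrict_opens`, `NeckCapping.lean`); and post-composition with
the open smooth embedding `h̄` (same model `𝓡∂ 4` on `T` and `W`) preserves immersions
(`Manifold.IsImmersion.openPartialHomeomorph_comp`, `HCobordismIdealCircleProofs.lean`), the
inverse of `h̄` being smooth on its open range for *any* model
(`contMDiffOn_symm_of_isSmoothEmbedding`, `SmoothEmbeddingCriteria.lean`).  Everything is proved.

## References

* A. A. Kosinski, *Differential Manifolds* (1993), VI §6. [Kosinski1993]
* J. M. Lee, *Introduction to Smooth Manifolds* (2013), Ch. 4–5.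
-/

noncomputable section

open scoped Manifold ContDiff Topology
open Set Function Metric

namespace Literature.Geometry.Symplectic

open Literature.Topology.FourManifolds

/-- The model vector space `ℝ⁴` of the tangent spaces. [folklore] -/
local notation "E4" => EuclideanSpace ℝ (Fin 4)
/-- The plane `ℝ²`. [folklore] -/
local notation "E2" => EuclideanSpace ℝ (Fin 2)
/-- The closed unit 4-ball. [folklore] -/
local notation "𝔻⁴" => (Metric.closedBall (0 : EuclideanSpace ℝ (Fin 4)) 1)
/-- Local notation: `𝕊 n` is the unit sphere in `EuclideanSpace ℝ (Fin (n + 1))`. -/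
local notation "𝕊 " n:arg => (Metric.sphere (0 : EuclideanSpace ℝ (Fin (n + 1))) 1)

attribute [local instance] fact_finrank_euclideanSpace_succ

/-! ### The model circle `θ ↦ (θ, 0)` is a smooth embedding into `D⁴` and into `T` -/

/-- The model circle in `D⁴` is the Legendrian unknot moved by the coordinate swap `x₁ ↔ x₂`.
[folklore] -/
theorem coe_coreTubePt_eq_closedBallCongr (θ : 𝕊 1) :
    ((coreTubePt θ : ↥(handleTube 3 2)) : 𝔻⁴) = closedBallCongr swapOneTwo (legendrianUnknot θ) := by
  apply Subtype.ext
  rw [coe_coe_coreTubePt, coe_closedBallCongr, coe_legendrianUnknot]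
  ext i; fin_cases i <;> simp

/-- **The model circle is a smooth embedding `𝕊¹ → D⁴`.** [folklore] -/
theorem isSmoothEmbedding_coe_coreTubePt :
    Manifold.IsSmoothEmbedding (𝓡 1) (𝓡∂ 4) ∞
      (fun θ : 𝕊 1 => ((coreTubePt θ : ↥(handleTube 3 2)) : 𝔻⁴)) := by
  have h := isSmoothEmbedding_legendrianUnknot.diffeomorph_comp (closedBallCongr swapOneTwo)
  refine (show (fun θ : 𝕊 1 => ((coreTubePt θ : ↥(handleTube 3 2)) : 𝔻⁴)) =
    closedBallCongr swapOneTwo ∘ legendrianUnknot from funext coe_coreTubePt_eq_closedBallCongr) ▸ h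

/-- **The model circle is a smooth embedding `𝕊¹ → T`** into Kosinski's tube (corestriction to
the open submanifold). [folklore] -/
theorem isSmoothEmbedding_coreTubePt :
    Manifold.IsSmoothEmbedding (𝓡 1) (𝓡∂ 4) ∞ (coreTubePt : 𝕊 1 → ↥(handleTube 3 2)) :=
  isSmoothEmbedding_coe_coreTubePt.codRestrict_opens (handleTube 3 2) fun θ => (coreTubePt θ).2

/-! ### The attaching circle -/

variable {W : Type*} [TopologicalSpace W] [T2Space W] [ChartedSpace (EuclideanHalfSpace 4) W]
  [IsManifold (𝓡∂ 4) ∞ W]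

/-- **The attaching circle of a 2-handle attaching map is a `C^∞` embedding `𝕊¹ → W`** (`W`
Hausdorff, for the closed-embedding argument on the compact circle). [folklore] -/
theorem isSmoothEmbedding_attachingCircle (h : HandleAttachingMap 3 2 W) :
    Manifold.IsSmoothEmbedding (𝓡 1) (𝓡∂ 4) ∞ h.attachingCircle := by
  have ho : Topology.IsOpenEmbedding h.toFun := ⟨h.isSmoothEmbedding.isEmbedding, h.isOpen_range⟩
  haveI : Nonempty ↥(handleTube 3 2) := ⟨coreTubePt (circlePt 0)⟩
  set Φ := ho.toOpenPartialHomeomorph h.toFun with hΦ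
  have hsrc : Φ.source = univ := ho.toOpenPartialHomeomorph_source _
  have hcoe : ⇑Φ = h.toFun := ho.toOpenPartialHomeomorph_apply _
  have hΦsm : ContMDiffOn (𝓡∂ 4) (𝓡∂ 4) ∞ Φ Φ.source := by
    rw [hcoe]; exact h.isSmoothEmbedding.contMDiff.contMDiffOn
  have hΦ'sm : ContMDiffOn (𝓡∂ 4) (𝓡∂ 4) ∞ Φ.symm Φ.target := by
    rw [ho.toOpenPartialHomeomorph_target]
    exact contMDiffOn_symm_of_isSmoothEmbedding h.isSmoothEmbedding ho
  have himm := isSmoothEmbedding_coreTubePt.isImmersion.openPartialHomeomorph_comp Φ hΦsm hΦ'sm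
    (fun θ => by rw [hsrc]; exact mem_univ _)
  rw [hcoe] at himm
  exact ⟨himm, (h.continuous_attachingCircle.isClosedEmbedding h.injective_attachingCircle).isEmbedding⟩

/-- **The attaching circle of a 2-handle attaching map is a knot in `∂W`.** [folklore] -/
theorem isBoundaryKnot_attachingCircle (h : HandleAttachingMap 3 2 W) : IsBoundaryKnot h.attachingCircle :=
  ⟨isSmoothEmbedding_attachingCircle h, h.isBoundaryPoint_attachingCircle⟩

end Literature.Geometry.Symplectic

end
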